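import Literature.Barriers.CriticalPhenomena.WeaklySAWSojournSimplex
import HarnessLib

/-!
# The continuous-time weakly self-avoiding walk: `χ(g,ν) = ∞` for `ν ≤ -(2d + 4g)`
# (finiteness of the critical value `ν_c > -∞` in every dimension)

Support file for the discharge of `Literature.Barriers.CriticalPhenomena.CTWSAW.BBS2015_lemA1`
(Bauerschmidt–Brydges–Slade 2015, Lemma A.1), in the jump-chain representation of
`WeaklySAWFourDimLogCorrections.lean` (`survival = c_{g,T}`, `susceptibility = χ(g,ν)`,
`criticalNu = ν_c = inf{ν | χ < ∞}`).

The printed proof that "`ν_c > -∞` also in lower dimensions" bounds `χ` below by the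
contribution of the strictly self-avoiding skeletons, evaluates `E(I(T) | S_{T,n}) = 2T²/(n+2)`
by order statistics and Jensen's inequality, and concludes with Stirling's formula and Laplace's
method [BBS2015, Appendix A, (A.5)–(A.14)]. Here the same conclusion — a divergent lower bound on
`χ(g,ν)` for `ν` below an explicit threshold — is reached by a shorter route suited to the
jump-chain definitions: keep only the STRAIGHT skeletons `0, e₀, 2e₀, …, ne₀` (for which
`I = Σ_a σ_a²`, the `σ_a` being the `n+1` sojourn times), and integrate over the total time `T`
FIRST: the substitution `(T, s) ↦ (s, T - Σ s)` (unit Jacobian,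
`lintegral_Ioi_lintegral_sojournSet`) turns `∫₀^∞ e^{-(2d+ν)T} ∫_{Δ_n(T)} e^{-gΣσ²} ds dT`
into the product `J^{n+1}`, `J = ∫₀^∞ e^{-(2d+ν)u - gu²} du`, and `J ≥ 1` as soon as
`ν ≤ -(2d + 4g)` (look at `u ∈ [1,2]`). Hence

* `susceptibility_eq_top_of_le_neg`: `χ(g,ν) = ∞` for `0 ≤ g`, `1 ≤ d`, `ν ≤ -(2d + 4g)`;
* `bddBelow_susceptibility_lt_top`: `{ν | χ(g,ν) < ∞}` is bounded below (by `-(2d+4g)`);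
* `neg_le_criticalNu`: `-(2d + 4g) ≤ ν_c(d,g)`; with `criticalNu_le_zero` of the `…Proofs` file,
  `ν_c ∈ [-(2d+4g), 0]` — the source's "`ν_c ∈ (-∞, 0]`" with an explicit (different, cruder)
  constant than its remark "`ν_c ∈ [-2d - 4gμ⁻¹, 0]`";
* `susceptibility_eq_top_of_lt_criticalNu'`: `χ(g,ν) = ∞` for `ν < ν_c` (unconditionally).

Also recorded: the straight skeleton as a Mathlib walk (`walkOfFn (straightWalk d n)` of
`SAWCount.lean`), its path integral, and `measurable_lintegral_sojournSet` (measurability in `T`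
of `∫_{Δ_n(T)} H(sojourns T s) ds`).

## References
* R. Bauerschmidt, D. C. Brydges, G. Slade, CMP 337 (2015), Appendix A, Lemma A.1 and its proof.
  [BauerschmidtBrydgesSlade2015LogCorr]
-/

noncomputable section

open MeasureTheory Set Filter Literature.Probability.LatticeModels Literature.Probability.Percolation
open Literature.Probability.RandomPlanarGeometry.SAW.Zd (walkOfFn getVert_walkOfFn length_walkOfFn
  straightWalk straightWalk_mem_saws mem_saws mem_box_of_walk)
open scoped ENNReal BigOperators Nat

namespace Literature.Barriers.CriticalPhenomena.CTWSAW

variable {d : ℕ}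

/-! ### Measurability in the total time -/

/-- `{(T, s) | s ∈ Δ_n(T)}` is measurable. [folklore] -/
theorem measurableSet_sojournSet_prod (n : ℕ) :
    MeasurableSet {p : ℝ × (Fin n → ℝ) | p.2 ∈ sojournSet n p.1} := by
  have : {p : ℝ × (Fin n → ℝ) | p.2 ∈ sojournSet n p.1} =
      (⋂ i, {p | 0 < p.2 i}) ∩ {p | ∑ i, p.2 i < p.1} := by
    ext p; simp [sojournSet]
  rw [this]
  refine (MeasurableSet.iInter fun i => ?_).inter ?_
  · exact measurableSet_lt measurable_const ((measurable_pi_apply i).comp measurable_snd)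
  · exact measurableSet_lt (Finset.measurable_sum _ fun i _ => (measurable_pi_apply i).comp measurable_snd)
      measurable_fst

/-- **Measurability in `T`** of `T ↦ ∫_{Δ_n(T)} H(sojourns T s) ds` for measurable `H ≥ 0`.
[folklore] -/
theorem measurable_lintegral_sojournSet {n : ℕ} {H : (Fin (n + 1) → ℝ) → ℝ≥0∞} (hH : Measurable H) :
    Measurable fun T : ℝ => ∫⁻ s in sojournSet n T, H (sojourns T s) := by
  set F : ℝ × (Fin n → ℝ) → ℝ≥0∞ :=
    {p : ℝ × (Fin n → ℝ) | p.2 ∈ sojournSet n p.1}.indicator fun p => H (sojourns p.1 p.2) with hF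
  have hFm : Measurable F :=
    (hH.comp (continuous_sojourns_uncurry n).measurable).indicator (measurableSet_sojournSet_prod n)
  have h : (fun T : ℝ => ∫⁻ s in sojournSet n T, H (sojourns T s)) = fun T => ∫⁻ s, F (T, s) := by
    funext T
    rw [← lintegral_indicator (measurableSet_sojournSet _ _)]
    rfl
  rw [h]
  exact hFm.lintegral_prod_right'

/-! ### The straight skeleton -/

section Straight

variable (d) [NeZero d] (n : ℕ)

/-- Consecutive sites of the straight walk are neighbours. [folklore] -/
theorem straightWalk_adj : ∀ i < n, (zdGraph d).Adj (straightWalk d n i) (straightWalk d n (i + 1)) :=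
  (mem_saws.1 (straightWalk_mem_saws d n)).2.2.1

/-- The straight walk starts at the origin. [folklore] -/
theorem straightWalk_zero : straightWalk d n 0 = 0 :=
  (mem_saws.1 (straightWalk_mem_saws d n)).1

/-- The straight walk visits distinct sites. [folklore] -/
theorem straightWalk_injOn : Set.InjOn (straightWalk d n) {i | i ≤ n} :=
  (mem_saws.1 (straightWalk_mem_saws d n)).2.2.2

end Straight

/-- The straight walk `0 → e₀ → ⋯ → ne₀` as a Mathlib walk of `zdGraph d` from the origin. -/
local notation3 "sW[" d ", " n "]" =>
  SimpleGraph.Walk.copy (walkOfFn (G := zdGraph d) (straightWalk d n) n (straightWalk_adj d n))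
    (straightWalk_zero d n) rfl

section Straight2

variable (d) [NeZero d] (n : ℕ)

/-- The straight walk has length `n`. [folklore] -/
theorem length_straight : (sW[d, n]).length = n := by
  simp

/-- The vertices of the straight walk. [folklore] -/
theorem getVert_straight {i : ℕ} (hi : i ≤ n) : (sW[d, n]).getVert i = straightWalk d n i := by
  simp [getVert_walkOfFn, min_eq_left hi]

/-- The straight walk is a length-`n` walk from `0` to `ne₀`. [folklore] -/
theorem straight_mem_finsetWalkLength :
    sW[d, n] ∈ (zdGraph d).finsetWalkLength n (0 : Site d) (straightWalk d n n) := by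
  rw [SimpleGraph.mem_finsetWalkLength_iff, length_straight]

/-- Its endpoint lies in the box `{-n,…,n}^d`. [folklore] -/
theorem straightWalk_mem_box : straightWalk d n n ∈ box d n :=
  mem_box_of_walk (sW[d, n]) (length_straight d n).le

/-- The straight walk has no self-intersections: `ω(i) = ω(j) ↔ i = j` on `[0, n]`. [folklore] -/
theorem getVert_straight_inj (i j : Fin ((sW[d, n]).length + 1)) :
    (sW[d, n]).getVert i = (sW[d, n]).getVert j → i = j := by
  intro h
  have hlen := length_straight d n
  have hi : (i : ℕ) ≤ n := by have := i.isLt; omega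
  have hj : (j : ℕ) ≤ n := by have := j.isLt; omega
  rw [getVert_straight d n hi, getVert_straight d n hj] at h
  exact Fin.ext (straightWalk_injOn d n hi hj h)

end Straight2

/-! ### Path integral of a skeleton without self-intersections -/

/-- For a skeleton visiting distinct sites, `I = Σ_a σ_a²` and
`∫_Δ e^{-gI} = ∫_{Δ_k(T)} e^{-g Σ_a σ_a²} ds`. [cite: BauerschmidtBrydgesSlade2015LogCorr, Appendix A (proof of Lemma A.1, the event S_{T,n})] -/
theorem pathIntegral_eq_of_getVert_inj (g T : ℝ) {x : Site d} (ω : (zdGraph d).Walk 0 x)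
    (hinj : ∀ i j : Fin (ω.length + 1), ω.getVert i = ω.getVert j → i = j) :
    pathIntegral g T ω = ∫⁻ s in sojournSet ω.length T,
      ENNReal.ofReal (Real.exp (-g * ∑ a, sojourns T s a * sojourns T s a)) := by
  unfold pathIntegral selfIntersection
  refine setLIntegral_congr_fun (measurableSet_sojournSet _ _) fun s _ => ?_
  congr 3
  refine Finset.sum_congr rfl fun i _ => ?_
  rw [Finset.sum_eq_single_of_mem i (Finset.mem_univ i) fun j _ hji => ?_, if_pos rfl]
  exact if_neg fun h => hji (hinj i j h).symm

/-- The one-sojourn weight `e^{-(2d+ν)u - gu²}` (as an `ℝ≥0∞`-valued function of `u`). -/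
local notation3 "φw[" d ", " g ", " ν "]" =>
  fun u : ℝ => ENNReal.ofReal (Real.exp (-(2 * (d : ℝ) + ν) * u - g * (u * u)))

/-- The one-sojourn weight is measurable. [folklore] -/
theorem measurable_weight (d : ℕ) (g ν : ℝ) : Measurable (φw[d, g, ν]) := by
  fun_prop

/-- **The Poisson and killing factors distribute over the sojourns**: since `Σ_a σ_a = T`,
`e^{-2dT} e^{-gΣσ_a²} e^{-νT} = Π_a e^{-(2d+ν)σ_a - gσ_a²}`. [folklore] -/
theorem exp_factors_eq_prod (d : ℕ) (g ν T : ℝ) {k : ℕ} (s : Fin k → ℝ) :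
    ENNReal.ofReal (Real.exp (-(2 * d) * T)) *
        ENNReal.ofReal (Real.exp (-g * ∑ a, sojourns T s a * sojourns T s a)) *
          ENNReal.ofReal (Real.exp (-ν * T)) =
      ∏ a, (φw[d, g, ν]) (sojourns T s a) := by
  rw [← ENNReal.ofReal_mul (Real.exp_pos _).le, ← ENNReal.ofReal_mul (by positivity),
    ← Real.exp_add, ← Real.exp_add,
    ← ENNReal.ofReal_prod_of_nonneg fun a _ => (Real.exp_pos _).le, ← Real.exp_sum]
  congr 2
  rw [Finset.sum_sub_distrib, ← Finset.mul_sum, ← Finset.mul_sum, sum_sojourns]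
  ring

/-- The `n`-jump straight-skeleton term of `χ`, as a function of `T`:
`e^{-2dT} (∫_{Δ_n(T)} e^{-gΣσ²}) e^{-νT} = ∫_{Δ_n(T)} Π_a φ(σ_a) ds`. [folklore] -/
theorem straightTerm_eq (d : ℕ) (g ν T : ℝ) (n : ℕ) :
    ENNReal.ofReal (Real.exp (-(2 * d) * T)) *
        (∫⁻ s in sojournSet n T,
          ENNReal.ofReal (Real.exp (-g * ∑ a, sojourns T s a * sojourns T s a))) *
          ENNReal.ofReal (Real.exp (-ν * T)) =
      ∫⁻ s in sojournSet n T, ∏ a, (φw[d, g, ν]) (sojourns T s a) := by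
  rw [← lintegral_const_mul' _ _ ENNReal.ofReal_ne_top, ← lintegral_mul_const' _ _ ENNReal.ofReal_ne_top]
  refine setLIntegral_congr_fun (measurableSet_sojournSet _ _) fun s _ => ?_
  exact exp_factors_eq_prod d g ν T s

/-- **The time-integrated straight-skeleton term factorises**:
`∫₀^∞ ∫_{Δ_n(T)} Π_a φ(σ_a) ds dT = J^{n+1}`, `J = ∫₀^∞ φ`. [folklore] -/
theorem lintegral_straightTerm (d : ℕ) (g ν : ℝ) (n : ℕ) :
    ∫⁻ T in Ioi 0, ∫⁻ s in sojournSet n T, ∏ a, (φw[d, g, ν]) (sojourns T s a) =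
      (∫⁻ u in Ioi 0, (φw[d, g, ν]) u) ^ (n + 1) := by
  rw [lintegral_Ioi_lintegral_sojournSet (H := fun σ => ∏ a, (φw[d, g, ν]) (σ a))
      (Finset.measurable_prod _ fun a _ => (measurable_weight d g ν).comp (measurable_pi_apply a)),
    setLIntegral_pi_Ioi_prod_eq_pow _ (measurable_weight d g ν)]

/-- **`J ≥ 1` below the threshold**: for `g ≥ 0` and `ν ≤ -(2d + 4g)`,
`∫₀^∞ e^{-(2d+ν)u - gu²} du ≥ 1` (the integrand is `≥ 1` on `[1, 2]`). [folklore] -/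
theorem one_le_lintegral_weight (d : ℕ) {g ν : ℝ} (hg : 0 ≤ g) (hν : ν ≤ -(2 * d + 4 * g)) :
    1 ≤ ∫⁻ u in Ioi 0, (φw[d, g, ν]) u := by
  have hsub : Icc (1 : ℝ) 2 ⊆ Ioi 0 := fun u hu => lt_of_lt_of_le one_pos hu.1
  calc (1 : ℝ≥0∞) = ∫⁻ _ in Icc (1 : ℝ) 2, 1 := by rw [setLIntegral_one, Real.volume_Icc]; norm_num
    _ ≤ ∫⁻ u in Icc (1 : ℝ) 2, (φw[d, g, ν]) u := by
        refine setLIntegral_mono' measurableSet_Icc fun u hu => ?_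
        rw [← ENNReal.ofReal_one]
        refine ENNReal.ofReal_le_ofReal (Real.one_le_exp ?_)
        have h1 : (4 * g) * u ≤ -(2 * (d : ℝ) + ν) * u :=
          mul_le_mul_of_nonneg_right (by linarith) (by linarith [hu.1])
        have h2 : g * (u * u) ≤ g * 4 := mul_le_mul_of_nonneg_left (by nlinarith [hu.1, hu.2]) hg
        nlinarith [hu.1]
    _ ≤ ∫⁻ u in Ioi 0, (φw[d, g, ν]) u := lintegral_mono_set hsub

/-! ### The divergent lower bound -/

/-- **`c_T` is at least its straight-skeleton part**:
`c_{g,T} ≥ e^{-2dT} Σ_n ∫_{Δ_n(T)} e^{-gΣ_aσ_a²} ds`.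
[cite: BauerschmidtBrydgesSlade2015LogCorr, Appendix A (proof of Lemma A.1, (A.5))] -/
theorem straight_le_survival (hd : 0 < d) (g T : ℝ) :
    ENNReal.ofReal (Real.exp (-(2 * d) * T)) *
        ∑' n : ℕ, ∫⁻ s in sojournSet n T,
          ENNReal.ofReal (Real.exp (-g * ∑ a, sojourns T s a * sojourns T s a)) ≤
      survival d g T := by
  haveI : NeZero d := ⟨hd.ne'⟩
  unfold survival weightedExpectation
  refine mul_le_mul' le_rfl (ENNReal.tsum_le_tsum fun n => ?_)
  have hterm : ∫⁻ s in sojournSet n T,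
      ENNReal.ofReal (Real.exp (-g * ∑ a, sojourns T s a * sojourns T s a)) =
      1 * pathIntegral g T (sW[d, n]) := by
    rw [one_mul, pathIntegral_eq_of_getVert_inj g T _ (getVert_straight_inj d n), length_straight]
  rw [hterm]
  refine le_trans ?_ (Finset.single_le_sum (f := fun x => ∑ ω ∈ (zdGraph d).finsetWalkLength n
    (0 : Site d) x, 1 * pathIntegral g T ω) (fun _ _ => bot_le) (straightWalk_mem_box d n))
  exact Finset.single_le_sum (f := fun ω => 1 * pathIntegral g T ω) (fun _ _ => bot_le)
    (straight_mem_finsetWalkLength d n)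

/-- **`χ` is at least the sum of the time-integrated straight-skeleton terms**:
`χ(g,ν) ≥ Σ_n J^{n+1}`. [cite: BauerschmidtBrydgesSlade2015LogCorr, Appendix A (proof of Lemma A.1, (A.5)–(A.11))] -/
theorem tsum_pow_le_susceptibility (hd : 0 < d) (g ν : ℝ) :
    ∑' n : ℕ, (∫⁻ u in Ioi 0, (φw[d, g, ν]) u) ^ (n + 1) ≤ susceptibility d g ν := by
  have hmeas : ∀ n : ℕ, Measurable fun T : ℝ =>
      ∫⁻ s in sojournSet n T, ∏ a, (φw[d, g, ν]) (sojourns T s a) := fun n =>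
    measurable_lintegral_sojournSet (H := fun σ => ∏ a, (φw[d, g, ν]) (σ a))
      (Finset.measurable_prod _ fun a _ => (measurable_weight d g ν).comp (measurable_pi_apply a))
  calc ∑' n : ℕ, (∫⁻ u in Ioi 0, (φw[d, g, ν]) u) ^ (n + 1)
      = ∑' n : ℕ, ∫⁻ T in Ioi 0, ∫⁻ s in sojournSet n T, ∏ a, (φw[d, g, ν]) (sojourns T s a) := by
        simp_rw [lintegral_straightTerm]
    _ = ∫⁻ T in Ioi 0, ∑' n : ℕ, ∫⁻ s in sojournSet n T, ∏ a, (φw[d, g, ν]) (sojourns T s a) :=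
        (lintegral_tsum fun n => (hmeas n).aemeasurable).symm
    _ = ∫⁻ T in Ioi 0, ENNReal.ofReal (Real.exp (-(2 * d) * T)) *
          (∑' n : ℕ, ∫⁻ s in sojournSet n T,
            ENNReal.ofReal (Real.exp (-g * ∑ a, sojourns T s a * sojourns T s a))) *
          ENNReal.ofReal (Real.exp (-ν * T)) := by
        refine lintegral_congr fun T => ?_
        rw [← ENNReal.tsum_mul_left, ← ENNReal.tsum_mul_right]
        simp_rw [straightTerm_eq]
    _ ≤ susceptibility d g ν := by
        unfold susceptibility
        exact lintegral_mono fun T => mul_le_mul' (straight_le_survival hd g T) le_rfl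

/-- **Lemma A.1, `ν_c > -∞` (quantified): `χ(g,ν) = ∞` for `ν ≤ -(2d + 4g)`**, `g ≥ 0`,
`d ≥ 1`. [cite: BauerschmidtBrydgesSlade2015LogCorr, Lemma A.1 (ν_c ∈ (-∞, 0]; proof, (A.5)–(A.14))] -/
theorem susceptibility_eq_top_of_le_neg (hd : 0 < d) {g ν : ℝ} (hg : 0 ≤ g)
    (hν : ν ≤ -(2 * d + 4 * g)) : susceptibility d g ν = ∞ := by
  refine eq_top_iff.2 (le_trans ?_ (tsum_pow_le_susceptibility hd g ν))
  calc (⊤ : ℝ≥0∞) = ∑' _ : ℕ, (1 : ℝ≥0∞) := (ENNReal.tsum_const_eq_top_of_ne_zero one_ne_zero).symm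
    _ ≤ ∑' n : ℕ, (∫⁻ u in Ioi 0, (φw[d, g, ν]) u) ^ (n + 1) :=
        ENNReal.tsum_le_tsum fun n => one_le_pow₀ (one_le_lintegral_weight d hg hν)

/-- `{ν | χ(g,ν) < ∞}` is bounded below (by `-(2d + 4g)`), `g ≥ 0`, `d ≥ 1`.
[cite: BauerschmidtBrydgesSlade2015LogCorr, Lemma A.1] -/
theorem bddBelow_susceptibility_lt_top (hd : 0 < d) {g : ℝ} (hg : 0 ≤ g) :
    BddBelow {ν : ℝ | susceptibility d g ν < ∞} := by
  refine ⟨-(2 * d + 4 * g), fun ν hν => le_of_lt (not_le.1 fun h => ?_)⟩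
  have := susceptibility_eq_top_of_le_neg hd hg h
  simp [this] at hν

/-- `{ν | χ(g,ν) < ∞}` is nonempty (`g ≥ 0`). [folklore] -/
theorem nonempty_susceptibility_lt_top (d : ℕ) {g : ℝ} (hg : 0 ≤ g) :
    {ν : ℝ | susceptibility d g ν < ∞}.Nonempty :=
  ⟨1, susceptibility_lt_top hg d one_pos⟩

/-- **`ν_c ≥ -(2d + 4g) > -∞`** (Lemma A.1: `ν_c ∈ (-∞, 0]`), `g ≥ 0`, `d ≥ 1`.
[cite: BauerschmidtBrydgesSlade2015LogCorr, Lemma A.1] -/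
theorem neg_le_criticalNu (hd : 0 < d) {g : ℝ} (hg : 0 ≤ g) :
    -(2 * d + 4 * g) ≤ criticalNu d g := by
  refine le_csInf (nonempty_susceptibility_lt_top d hg) fun ν hν => le_of_lt (not_le.1 fun h => ?_)
  have := susceptibility_eq_top_of_le_neg hd hg h
  simp [this] at hν

/-- Below `ν_c` the susceptibility is infinite (`g ≥ 0`, `d ≥ 1`; the boundedness hypothesis of
`susceptibility_eq_top_of_lt_criticalNu` discharged). [cite: BauerschmidtBrydgesSlade2015LogCorr, Lemma A.1] -/
theorem susceptibility_eq_top_of_lt_criticalNu' (hd : 0 < d) {g ν : ℝ} (hg : 0 ≤ g)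
    (hν : ν < criticalNu d g) : susceptibility d g ν = ∞ :=
  susceptibility_eq_top_of_lt_criticalNu (bddBelow_susceptibility_lt_top hd hg) hν

end Literature.Barriers.CriticalPhenomena.CTWSAW
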